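import Summits.AtomisticToContinuum.Crystallization.Theses.ChessboardParticlePlanes

/-!
# Crux `ChessboardParticlePlanes.LjPlaneChessboard` (stmt-AtomisticToContinuum-6709), line `Sketch`,
# stub `stub_verticalPeriod` — the vertical period of a layer-confined periodic configuration

If the occupied heights (third coordinates of the points) of a periodic configuration `Q` of `ℝ³`
are pairwise equal or at least `3/4` apart, then the heights `g 2` of the periods `g ∈ G = Q.lattice`
form the cyclic group `c₀ℤ` for some `c₀ > 0`, and `c₀` itself is the height of a period.  [folklore]

PROOF.  The heights of the periods form the additive subgroup `S = π(G)` of `ℝ`, `π x = x 2`.  A period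
`g` with `0 < g 2 < 3/4` would move a point `y` of the (non-empty) configuration to the point `y + g`
at the forbidden height distance `g 2`; hence `S ∩ (0, 3/4) = ∅` and `S` is cyclic
(`AddSubgroup.cyclic_of_isolated_zero`), `S = bℤ`.  Finally `b ≠ 0`: otherwise every period is
horizontal, so the `ℝ`-span of `G`, which is all of `ℝ³` (`IsZLattice.span_top`), would lie in the
kernel of `π`, which misses `e₂`.  Take `c₀ = |b|`.
-/

noncomputable section

namespace Summit.AtomisticToContinuum.Crystallization.Theorems.ChessboardParticlePlanesLjPlaneChessboard

open Literature.MathematicalPhysics.StatisticalMechanics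

/-- A period of a periodic configuration of `ℝ³` whose occupied heights are pairwise equal or
`≥ 3/4` apart is either horizontal or has height of absolute value `≥ 3/4`. [folklore] -/
theorem verticalPeriod_gap (Q : PeriodicConfiguration 3)
    (hsep : ∀ x ∈ Q.points, ∀ y ∈ Q.points, x 2 ≠ y 2 → (3 : ℝ) / 4 ≤ |x 2 - y 2|)
    {g : EuclideanSpace ℝ (Fin 3)} (hg : g ∈ Q.lattice) (hg0 : g 2 ≠ 0) :
    (3 : ℝ) / 4 ≤ |g 2| := by
  obtain ⟨y, hy⟩ := Q.motif_nonempty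
  have hy' : y ∈ Q.points := Q.mem_points_of_mem_motif hy
  have hyg : y + g ∈ Q.points := Q.add_mem_points hy' hg
  have h := hsep (y + g) hyg y hy' (by simpa using hg0)
  simpa using h

/-- **Stub 1 — vertical period (S/M).**  If the occupied heights of a periodic configuration
`Q` of `ℝ³` are pairwise equal or `≥ 3/4` apart, then the heights `g 2` of the periods `g ∈ G`
form the cyclic group `c₀ℤ` for some `c₀ > 0`, attained by a period.  Proof: `g ↦ g 2` maps `G`
onto an additive subgroup `S` of `ℝ` with `S ∩ (0, 3/4) = ∅` (a period `g` with `0 < g₂ < 3/4`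
would move a point of the non-empty configuration to a forbidden height), hence `S` is cyclic
(`AddSubgroup.cyclic_of_isolated_zero`), `S = c₀ℤ`; `c₀ ≠ 0` because `G` spans `ℝ³`.
[folklore] -/
theorem stub_verticalPeriod :
    ∀ Q : PeriodicConfiguration 3,
      (∀ x ∈ Q.points, ∀ y ∈ Q.points, x 2 ≠ y 2 → (3 : ℝ) / 4 ≤ |x 2 - y 2|) →
      ∃ c₀ : ℝ, 0 < c₀ ∧ (∃ g ∈ Q.lattice, g 2 = c₀) ∧ ∀ g ∈ Q.lattice, ∃ k : ℤ, g 2 = c₀ * k := by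
  intro Q hsep
  -- the height subgroup `S = π(G)`
  let π : EuclideanSpace ℝ (Fin 3) →ₗ[ℝ] ℝ := EuclideanSpace.projₗ (2 : Fin 3)
  let S : AddSubgroup ℝ := Q.lattice.toAddSubgroup.map π.toAddMonoidHom
  have hS : ∀ s : ℝ, s ∈ S ↔ ∃ g ∈ Q.lattice, g 2 = s := by
    intro s
    simp [S, π]
  -- `S` misses `(0, 3/4)`
  have hd : Disjoint (S : Set ℝ) (Set.Ioo 0 (3 / 4)) := by
    rw [Set.disjoint_left]
    rintro s hs ⟨h0, h1⟩
    obtain ⟨g, hg, rfl⟩ := (hS s).1 hs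
    have h := verticalPeriod_gap Q hsep hg h0.ne'
    rw [abs_of_pos h0] at h
    linarith
  -- hence `S` is cyclic
  obtain ⟨b, hb⟩ := AddSubgroup.cyclic_of_isolated_zero (by norm_num : (0 : ℝ) < 3 / 4) hd
  -- with a non-zero generator
  have hb0 : b ≠ 0 := by
    intro hb0
    -- otherwise every period is horizontal, ...
    have hz : ∀ g ∈ Q.lattice, g 2 = 0 := fun g hg => by
      have hgS : g 2 ∈ S := (hS _).2 ⟨g, hg, rfl⟩
      rw [hb, hb0, AddSubgroup.closure_singleton_zero] at hgS
      simpa using hgS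
    -- ... so the `ℝ`-span of `G`, which is all of `ℝ³`, lies in `ker π`, which misses `e₂`
    have hle : Submodule.span ℝ (Q.lattice : Set (EuclideanSpace ℝ (Fin 3))) ≤ LinearMap.ker π := by
      rw [Submodule.span_le]
      intro g hg
      simpa [π] using hz g hg
    rw [Q.isZLattice.span_top] at hle
    have hmem := hle (Submodule.mem_top : EuclideanSpace.single (2 : Fin 3) (1 : ℝ) ∈ ⊤)
    simp [π] at hmem
  refine ⟨|b|, abs_pos.2 hb0, ?_, ?_⟩
  · -- `|b| = ±b` is the height of a period
    have hbS : b ∈ S := by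
      rw [hb]
      exact AddSubgroup.mem_closure_singleton_self b
    rcases abs_choice b with h | h
    · obtain ⟨g, hg, hg2⟩ := (hS b).1 hbS
      exact ⟨g, hg, hg2.trans h.symm⟩
    · obtain ⟨g, hg, hg2⟩ := (hS (-b)).1 (S.neg_mem hbS)
      exact ⟨g, hg, hg2.trans h.symm⟩
  · -- every height is an integer multiple of `|b|`
    intro g hg
    have hgS : g 2 ∈ S := (hS _).2 ⟨g, hg, rfl⟩
    rw [hb, AddSubgroup.mem_closure_singleton] at hgS
    obtain ⟨n, hn⟩ := hgS
    rcases abs_choice b with h | h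
    · exact ⟨n, by rw [h, ← hn, zsmul_eq_mul, mul_comm]⟩
    · exact ⟨-n, by rw [h, ← hn, zsmul_eq_mul]; push_cast; ring⟩

end Summit.AtomisticToContinuum.Crystallization.Theorems.ChessboardParticlePlanesLjPlaneChessboard

end
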